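import Summits.KontsevichZagierPeriods.KontsevichZagierPeriods.Theorems.RootDecompRationalCubeDichotomyArctanFibreP4

/-!
# Arctan-fibre calculus for `RationalCubePiKernelSingle` (route `RootDecompRationalCubeDichotomy`, crux stmt-KontsevichZagierPeriods-26322) at `m = 2` · part 5/9

Cell `decomp-kz`, lens 2 (decomp-kz-lens-2 g7): the GENERIC (arctan-fibre) side of the first open rung `m = 2` of
`RationalCubePiKernelSingle` decided INSIDE the Kontsevich–Zagier calculus with `N = 0`, by rules 1+2 only: fibred Möbius
charts `x ↦ x(q+r)/(q+rx)` (`MoebiusData.rel`), the TANGENT-ADDITION chart `x ↦ x(1−p)/(1−px²)` = the group law of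
`tan` as a move (`TanData.tan_add`), Serret's base involution `y ↦ (1−y)/(1+y)` (`rel_serret`), one moving-centre
dissection with null surgery (§8), odd-symmetry vanishing (§7b).  Decided census classes: `π·log 2` (`pilog2_rel`,
census pair #33), Catalan (`catalan_rel`, #32), dilogarithm classes `dilogA_rel` (#28), `dilogB_rel` (#30),
`dilogC_rel` (#24), seven moment relations; §9 the LITERAL binder instances of `RationalCubePiKernelSingle` at
`m = 2`, `N = 0` (the route decl is not referenced by name, so these modules do not import the route file);
§10 six UNIFORM CLASSES `single_classSwap/Reflect/Halve/Moebius/Serret/TanAdd`.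

Source: `HOME/decomp-kz-lens-2/g7/ArctanFibreCalculus.lean` sha256 964497cf335d1c59 (2144 l; critic decomp-kz-crit-1 g2
CLEARED 2026-08-30T09:13:02Z incl. transcription numerics, std axioms), split into 9 modules by the landing seat
decomp-kz-census-1 g7 (contexts re-opened per part; generic docstrings added where the source had none).
No `sorry`; standard axioms.  References: [cite: KontsevichZagier2001, §1.2]; J.-A. Serret (1844).
-/

noncomputable section

open Set MeasureTheory MvPolynomial
open Literature.ModelTheory.ExponentialFields (IsSemialgebraic)
open Literature.NumberTheory.Transcendental
open Literature.NumberTheory.Transcendental.KZ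
open Literature.NumberTheory.Transcendental.KZ.RFun
open Summit.KontsevichZagierPeriods.KontsevichZagierPeriods.Theorems

namespace Summit.KontsevichZagierPeriods.RootDecompRationalCubeDichotomy.ArctanFibre

-- PRIVATE copy (landed twin elsewhere / dedup.landed): mem_cube_two, snoc_two_zero, snoc_two_one, init_apply_zero, vec_zero, vec_one
/-- `mem_cube_two`: auxiliary theorem of the arctan-fibre calculus for `RationalCubePiKernelSingle` (stmt-26322) — see the module docstring; verbatim from the lens file. -/
private theorem mem_cube_two {z : Fin 2 → ℝ} (hz : z ∈ KZ.cube 2) :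
    (0 ≤ z 0 ∧ z 0 ≤ 1) ∧ (0 ≤ z 1 ∧ z 1 ≤ 1) := ⟨hz 0, hz 1⟩

/-- `snoc_two_zero`: auxiliary theorem of the arctan-fibre calculus for `RationalCubePiKernelSingle` (stmt-26322) — see the module docstring; verbatim from the lens file. -/
@[simp] private theorem snoc_two_zero (y : Fin 1 → ℝ) (s : ℝ) : (Fin.snoc y s : Fin 2 → ℝ) 0 = y 0 := rfl

/-- `snoc_two_one`: auxiliary theorem of the arctan-fibre calculus for `RationalCubePiKernelSingle` (stmt-26322) — see the module docstring; verbatim from the lens file. -/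
@[simp] private theorem snoc_two_one (y : Fin 1 → ℝ) (s : ℝ) : (Fin.snoc y s : Fin 2 → ℝ) 1 = s := rfl

/-- `init_apply_zero`: auxiliary theorem of the arctan-fibre calculus for `RationalCubePiKernelSingle` (stmt-26322) — see the module docstring; verbatim from the lens file. -/
@[simp] private theorem init_apply_zero (z : Fin 2 → ℝ) : Fin.init z 0 = z 0 := rfl

/-- `vec_zero`: auxiliary theorem of the arctan-fibre calculus for `RationalCubePiKernelSingle` (stmt-26322) — see the module docstring; verbatim from the lens file. -/
@[simp] private theorem vec_zero (a b : ℝ) : (![a, b] : Fin 2 → ℝ) 0 = a := rfl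

/-- `vec_one`: auxiliary theorem of the arctan-fibre calculus for `RationalCubePiKernelSingle` (stmt-26322) — see the module docstring; verbatim from the lens file. -/
@[simp] private theorem vec_one (a b : ℝ) : (![a, b] : Fin 2 → ℝ) 1 = b := rfl

section Objects

/-- Tangent-addition data `a₁ = y`, `a₂ = (1−y)/(1+y)` (`arctan a₁ + arctan a₂ = π/4`). -/
def tdYS : TanData where
  A₁ := sY
  A₂ := sS
  hp := fun t ht => by
    have h0 := ht.1
    have h1 := ht.2
    have hp : (0 : ℝ) < 1 + t := by linarith
    rw [ev_sY, ev_sS, mul_div_assoc']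
    constructor
    · rw [div_lt_one hp]; nlinarith
    · have : (0 : ℝ) ≤ t * (1 - t) / (1 + t) := div_nonneg (by nlinarith) hp.le
      linarith

/-- `tdAB_a₁`: auxiliary theorem of the arctan-fibre calculus for `RationalCubePiKernelSingle` (stmt-26322) — see the module docstring; verbatim from the lens file. -/
@[simp] theorem tdAB_a₁ (t : ℝ) : tdAB.a₁ t = 1 / (2 + t) := by simp [TanData.a₁, tdAB]
/-- `tdAB_a₂`: auxiliary theorem of the arctan-fibre calculus for `RationalCubePiKernelSingle` (stmt-26322) — see the module docstring; verbatim from the lens file. -/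
@[simp] theorem tdAB_a₂ (t : ℝ) : tdAB.a₂ t = (1 + t) / (3 + t) := by simp [TanData.a₂, tdAB]
/-- `tdYS_a₁`: auxiliary theorem of the arctan-fibre calculus for `RationalCubePiKernelSingle` (stmt-26322) — see the module docstring; verbatim from the lens file. -/
@[simp] theorem tdYS_a₁ (t : ℝ) : tdYS.a₁ t = t := by simp [TanData.a₁, tdYS]
/-- `tdYS_a₂`: auxiliary theorem of the arctan-fibre calculus for `RationalCubePiKernelSingle` (stmt-26322) — see the module docstring; verbatim from the lens file. -/
@[simp] theorem tdYS_a₂ (t : ℝ) : tdYS.a₂ t = (1 - t) / (1 + t) := by simp [TanData.a₂, tdYS]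

/-- Möbius data `q = 1 + y`, `r = 1` (the chart `x ↦ x(2+y)/(1+y+x)`). -/
def mdB : MoebiusData where
  Q := 1 + X 0
  R := 1
  hQ := fun t ht => by have := ht.1; simp; linarith
  hQR := fun t ht => by have := ht.1; simp; linarith

/-- `mdB_q`: auxiliary theorem of the arctan-fibre calculus for `RationalCubePiKernelSingle` (stmt-26322) — see the module docstring; verbatim from the lens file. -/
@[simp] theorem mdB_q (t : ℝ) : mdB.q t = 1 + t := by simp [MoebiusData.q, mdB]
/-- `mdB_r`: auxiliary theorem of the arctan-fibre calculus for `RationalCubePiKernelSingle` (stmt-26322) — see the module docstring; verbatim from the lens file. -/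
@[simp] theorem mdB_r (t : ℝ) : mdB.r t = 1 := by simp [MoebiusData.r, mdB]

/-! ### The `π log 2` relations on the whole square -/

/-- `π1`: `[B*] ≡ [J₂]` — the Möbius chart `x ↦ x(2+y)/(1+y+x)`. -/
theorem cBst_J2 : KZ.of cBst.rep - KZ.of J2.rep ∈ KZ.relations :=
  mdB.rel cBst J2 fun z hz => by
    obtain ⟨⟨hy0, hy1⟩, hx0, hx1⟩ := mem_cube_two hz
    have hy1' : (0 : ℝ) ≤ 1 - z 0 := by linarith
    have hx1' : (0 : ℝ) ≤ 1 - z 1 := by linarith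
    rw [cBst_fn, J2_fn]
    simp only [vec_zero, vec_one, mdB_q, mdB_r]
    field_simp (disch := first | assumption | positivity | (with_unfolding_all (apply ne_of_gt; nlinarith [mul_nonneg hx0 hy0, mul_nonneg hx0 hx1', mul_nonneg hy0 hy1', mul_nonneg hx1' hy1', sq_nonneg (2 * z 1 - 1), sq_nonneg (2 * z 0 - 1)])))
    ring

/-- `π2`: `[J₂] + [N] ≡ [p₀]` — tangent addition `arctan 1/(2+y) + arctan (1+y)/(3+y) = π/4`. -/
theorem J2_Nn_p0 : KZ.of J2.rep + KZ.of Nn.rep - KZ.of p0.rep ∈ KZ.relations :=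
  tdAB.tan_add (fun t => 1 / (1 + t)) J2 Nn p0
    (fun z hz => by
      obtain ⟨⟨hy0, hy1⟩, hx0, hx1⟩ := mem_cube_two hz
      have hy1' : (0 : ℝ) ≤ 1 - z 0 := by linarith
      have hx1' : (0 : ℝ) ≤ 1 - z 1 := by linarith
      rw [J2_fn, tdAB_a₁]
      field_simp (disch := first | assumption | positivity | (with_unfolding_all (apply ne_of_gt; nlinarith [mul_nonneg hx0 hy0, mul_nonneg hx0 hx1', mul_nonneg hy0 hy1', mul_nonneg hx1' hy1', sq_nonneg (2 * z 1 - 1), sq_nonneg (2 * z 0 - 1)]))))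
    (fun z hz => by
      obtain ⟨⟨hy0, hy1⟩, hx0, hx1⟩ := mem_cube_two hz
      have hy1' : (0 : ℝ) ≤ 1 - z 0 := by linarith
      have hx1' : (0 : ℝ) ≤ 1 - z 1 := by linarith
      rw [Nn_fn, tdAB_a₂]
      field_simp (disch := first | assumption | positivity | (with_unfolding_all (apply ne_of_gt; nlinarith [mul_nonneg hx0 hy0, mul_nonneg hx0 hx1', mul_nonneg hy0 hy1', mul_nonneg hx1' hy1', sq_nonneg (2 * z 1 - 1), sq_nonneg (2 * z 0 - 1)]))))
    (fun z hz => by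
      obtain ⟨⟨hy0, hy1⟩, hx0, hx1⟩ := mem_cube_two hz
      have hy1' : (0 : ℝ) ≤ 1 - z 0 := by linarith
      have hx1' : (0 : ℝ) ≤ 1 - z 1 := by linarith
      have e1 : tdAB.a₁ (z 0) + tdAB.a₂ (z 0) = (z 0 ^ 2 + 4 * z 0 + 5) / ((2 + z 0) * (3 + z 0)) := by
        rw [tdAB_a₁, tdAB_a₂]
        field_simp (disch := first | assumption | positivity | (with_unfolding_all (apply ne_of_gt; nlinarith [mul_nonneg hx0 hy0, mul_nonneg hx0 hx1', mul_nonneg hy0 hy1', mul_nonneg hx1' hy1', sq_nonneg (2 * z 1 - 1), sq_nonneg (2 * z 0 - 1)])))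
        ring
      have e2 : 1 - tdAB.a₁ (z 0) * tdAB.a₂ (z 0) = (z 0 ^ 2 + 4 * z 0 + 5) / ((2 + z 0) * (3 + z 0)) := by
        rw [tdAB_a₁, tdAB_a₂]
        field_simp (disch := first | assumption | positivity | (with_unfolding_all (apply ne_of_gt; nlinarith [mul_nonneg hx0 hy0, mul_nonneg hx0 hx1', mul_nonneg hy0 hy1', mul_nonneg hx1' hy1', sq_nonneg (2 * z 1 - 1), sq_nonneg (2 * z 0 - 1)])))
        ring
      rw [p0_fn, e1, e2]
      field_simp (disch := first | assumption | positivity | (with_unfolding_all (apply ne_of_gt; nlinarith [mul_nonneg hx0 hy0, mul_nonneg hx0 hx1', mul_nonneg hy0 hy1', mul_nonneg hx1' hy1', sq_nonneg (2 * z 1 - 1), sq_nonneg (2 * z 0 - 1)]))))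

/-- `π3`: `[J₂] ≡ [N]` — Serret's involution of the base. -/
theorem J2_Nn : KZ.of J2.rep - KZ.of Nn.rep ∈ KZ.relations :=
  rel_serret J2 Nn fun z hz => by
    obtain ⟨⟨hy0, hy1⟩, hx0, hx1⟩ := mem_cube_two hz
    have hy1' : (0 : ℝ) ≤ 1 - z 0 := by linarith
    have hx1' : (0 : ℝ) ≤ 1 - z 1 := by linarith
    rw [J2_fn, Nn_fn, vec_zero, vec_one, serret]
    field_simp (disch := first | assumption | positivity | (with_unfolding_all (apply ne_of_gt; nlinarith [mul_nonneg hx0 hy0, mul_nonneg hx0 hx1', mul_nonneg hy0 hy1', mul_nonneg hx1' hy1', sq_nonneg (2 * z 1 - 1), sq_nonneg (2 * z 0 - 1)])))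
    ring

/-- `2•[J₂] ≡ [p₀]`. -/
theorem two_J2_p0 : 2 • KZ.of J2.rep - KZ.of p0.rep ∈ KZ.relations := by
  convert add_mem J2_Nn_p0 J2_Nn using 1
  abel

/-- `π10`: `[J₁] + [J₁'] ≡ [p₀]` — tangent addition `arctan y + arctan (1−y)/(1+y) = π/4`. -/
theorem J1_J1p_p0 : KZ.of J1.rep + KZ.of J1p.rep - KZ.of p0.rep ∈ KZ.relations :=
  tdYS.tan_add (fun t => 1 / (1 + t)) J1 J1p p0
    (fun z hz => by
      obtain ⟨⟨hy0, hy1⟩, hx0, hx1⟩ := mem_cube_two hz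
      have hy1' : (0 : ℝ) ≤ 1 - z 0 := by linarith
      have hx1' : (0 : ℝ) ≤ 1 - z 1 := by linarith
      rw [J1_fn, tdYS_a₁]
      field_simp (disch := first | assumption | positivity | (with_unfolding_all (apply ne_of_gt; nlinarith [mul_nonneg hx0 hy0, mul_nonneg hx0 hx1', mul_nonneg hy0 hy1', mul_nonneg hx1' hy1', sq_nonneg (2 * z 1 - 1), sq_nonneg (2 * z 0 - 1)]))))
    (fun z hz => by
      obtain ⟨⟨hy0, hy1⟩, hx0, hx1⟩ := mem_cube_two hz
      have hy1' : (0 : ℝ) ≤ 1 - z 0 := by linarith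
      have hx1' : (0 : ℝ) ≤ 1 - z 1 := by linarith
      rw [J1p_fn, tdYS_a₂]
      field_simp (disch := first | assumption | positivity | (with_unfolding_all (apply ne_of_gt; nlinarith [mul_nonneg hx0 hy0, mul_nonneg hx0 hx1', mul_nonneg hy0 hy1', mul_nonneg hx1' hy1', sq_nonneg (2 * z 1 - 1), sq_nonneg (2 * z 0 - 1)]))))
    (fun z hz => by
      obtain ⟨⟨hy0, hy1⟩, hx0, hx1⟩ := mem_cube_two hz
      have hy1' : (0 : ℝ) ≤ 1 - z 0 := by linarith
      have hx1' : (0 : ℝ) ≤ 1 - z 1 := by linarith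
      have e1 : tdYS.a₁ (z 0) + tdYS.a₂ (z 0) = (1 + z 0 ^ 2) / (1 + z 0) := by
        rw [tdYS_a₁, tdYS_a₂]
        field_simp (disch := first | assumption | positivity | (with_unfolding_all (apply ne_of_gt; nlinarith [mul_nonneg hx0 hy0, mul_nonneg hx0 hx1', mul_nonneg hy0 hy1', mul_nonneg hx1' hy1', sq_nonneg (2 * z 1 - 1), sq_nonneg (2 * z 0 - 1)])))
        ring
      have e2 : 1 - tdYS.a₁ (z 0) * tdYS.a₂ (z 0) = (1 + z 0 ^ 2) / (1 + z 0) := by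
        rw [tdYS_a₁, tdYS_a₂]
        field_simp (disch := first | assumption | positivity | (with_unfolding_all (apply ne_of_gt; nlinarith [mul_nonneg hx0 hy0, mul_nonneg hx0 hx1', mul_nonneg hy0 hy1', mul_nonneg hx1' hy1', sq_nonneg (2 * z 1 - 1), sq_nonneg (2 * z 0 - 1)])))
        ring
      rw [p0_fn, e1, e2]
      field_simp (disch := first | assumption | positivity | (with_unfolding_all (apply ne_of_gt; nlinarith [mul_nonneg hx0 hy0, mul_nonneg hx0 hx1', mul_nonneg hy0 hy1', mul_nonneg hx1' hy1', sq_nonneg (2 * z 1 - 1), sq_nonneg (2 * z 0 - 1)]))))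

/-- `π11`: `[J₁'] ≡ [J₁]` — Serret's involution of the base. -/
theorem J1p_J1 : KZ.of J1p.rep - KZ.of J1.rep ∈ KZ.relations :=
  rel_serret J1p J1 fun z hz => by
    obtain ⟨⟨hy0, hy1⟩, hx0, hx1⟩ := mem_cube_two hz
    have hy1' : (0 : ℝ) ≤ 1 - z 0 := by linarith
    have hx1' : (0 : ℝ) ≤ 1 - z 1 := by linarith
    rw [J1p_fn, J1_fn, vec_zero, vec_one, serret]
    field_simp (disch := first | assumption | positivity | (with_unfolding_all (apply ne_of_gt; nlinarith [mul_nonneg hx0 hy0, mul_nonneg hx0 hx1', mul_nonneg hy0 hy1', mul_nonneg hx1' hy1', sq_nonneg (2 * z 1 - 1), sq_nonneg (2 * z 0 - 1)])))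
    ring

/-- `2•[J₁'] ≡ [p₀]`. -/
theorem two_J1p_p0 : 2 • KZ.of J1p.rep - KZ.of p0.rep ∈ KZ.relations := by
  convert add_mem J1_J1p_p0 J1p_J1 using 1
  abel

/-- `[B*] ≡ [B]` (swap). -/
theorem cBst_cBcen : KZ.of cBst.rep - KZ.of cBcen.rep ∈ KZ.relations := by
  have h : KZ.of (swap cBst).rep - KZ.of cBcen.rep ∈ KZ.relations :=
    rel_of_eqOn fun z hz => by
      rw [fn_swap, cBst_fn, cBcen_fn, vec_zero, vec_one]
      congr 1; ring
  convert add_mem (rel_swap cBst) h using 1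
  abel

/-- `3•[p₀] ≡ 6•[B]`. -/
theorem three_p0_six_cBcen : 3 • KZ.of p0.rep - 6 • KZ.of cBcen.rep ∈ KZ.relations := by
  have h : KZ.of p0.rep - 2 • KZ.of cBcen.rep ∈ KZ.relations := by
    convert sub_mem (nsmul_mem (sub_mem cBst_cBcen cBst_J2) 2) two_J2_p0 using 1
    abel
  convert nsmul_mem h 3 using 1
  abel

/-- `cQ3_ne`: auxiliary theorem of the arctan-fibre calculus for `RationalCubePiKernelSingle` (stmt-26322) — see the module docstring; verbatim from the lens file. -/
theorem cQ3_ne : ∀ z ∈ KZ.cube 2, aeval z (1 + X 1 + X 0 - 2 * X 1 * X 0 : MvPolynomial (Fin 2) ℚ) ≠ 0 := by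
  intro z hz
  obtain ⟨⟨hy0, hy1⟩, hx0, hx1⟩ := mem_cube_two hz
  have hy1' : (0 : ℝ) ≤ 1 - z 0 := by linarith
  have hx1' : (0 : ℝ) ≤ 1 - z 1 := by linarith
  have h : aeval z (1 + X 1 + X 0 - 2 * X 1 * X 0 : MvPolynomial (Fin 2) ℚ) = (1 + z 1 + z 0 - 2 * z 1 * z 0) := by simp
  rw [h]
  have hp : (0 : ℝ) < (1 + z 1 + z 0 - 2 * z 1 * z 0) := by nlinarith [mul_nonneg hx0 hy0, mul_nonneg hx0 hx1', mul_nonneg hy0 hy1', mul_nonneg hx1' hy1', sq_nonneg (2 * z 1 - 1), sq_nonneg (2 * z 0 - 1)]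
  exact hp.ne'

/-- `[□, 1/(1+x+y−2xy)]` (census tuple `[1,1,1,0,-2,0]`, class `D2`, `×1/6`). -/
def cQ3 : RFun 2 := ⟨1, 1 + X 1 + X 0 - 2 * X 1 * X 0, cQ3_ne⟩

/-- `cQ3_fn`: auxiliary theorem of the arctan-fibre calculus for `RationalCubePiKernelSingle` (stmt-26322) — see the module docstring; verbatim from the lens file. -/
theorem cQ3_fn (z : Fin 2 → ℝ) : cQ3.fn z = 1 / (1 + z 1 + z 0 - 2 * z 1 * z 0) := by
  simp [cQ3, fn_apply]

/-- `cQ3_pos`: auxiliary theorem of the arctan-fibre calculus for `RationalCubePiKernelSingle` (stmt-26322) — see the module docstring; verbatim from the lens file. -/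
theorem cQ3_pos {z : Fin 2 → ℝ} (hz : z ∈ KZ.cube 2) : (0 : ℝ) < (1 + z 1 + z 0 - 2 * z 1 * z 0) := by
  obtain ⟨⟨hy0, hy1⟩, hx0, hx1⟩ := mem_cube_two hz
  have hy1' : (0 : ℝ) ≤ 1 - z 0 := by linarith
  have hx1' : (0 : ℝ) ≤ 1 - z 1 := by linarith
  nlinarith [mul_nonneg hx0 hy0, mul_nonneg hx0 hx1', mul_nonneg hy0 hy1', mul_nonneg hx1' hy1', sq_nonneg (2 * z 1 - 1), sq_nonneg (2 * z 0 - 1)]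

/-- `cQ4_ne`: auxiliary theorem of the arctan-fibre calculus for `RationalCubePiKernelSingle` (stmt-26322) — see the module docstring; verbatim from the lens file. -/
theorem cQ4_ne : ∀ z ∈ KZ.cube 2, aeval z (2 + X 1 + 2 * X 0 - 2 * X 1 * X 0 : MvPolynomial (Fin 2) ℚ) ≠ 0 := by
  intro z hz
  obtain ⟨⟨hy0, hy1⟩, hx0, hx1⟩ := mem_cube_two hz
  have hy1' : (0 : ℝ) ≤ 1 - z 0 := by linarith
  have hx1' : (0 : ℝ) ≤ 1 - z 1 := by linarith
  have h : aeval z (2 + X 1 + 2 * X 0 - 2 * X 1 * X 0 : MvPolynomial (Fin 2) ℚ) = (2 + z 1 + 2 * z 0 - 2 * z 1 * z 0) := by simp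
  rw [h]
  have hp : (0 : ℝ) < (2 + z 1 + 2 * z 0 - 2 * z 1 * z 0) := by nlinarith [mul_nonneg hx0 hy0, mul_nonneg hx0 hx1', mul_nonneg hy0 hy1', mul_nonneg hx1' hy1', sq_nonneg (2 * z 1 - 1), sq_nonneg (2 * z 0 - 1)]
  exact hp.ne'

/-- `[□, 1/(2+x+2y−2xy)]` (census tuple `[2,1,2,0,-2,0]`, class `D2`, `×1/12`). -/
def cQ4 : RFun 2 := ⟨1, 2 + X 1 + 2 * X 0 - 2 * X 1 * X 0, cQ4_ne⟩

/-- `cQ4_fn`: auxiliary theorem of the arctan-fibre calculus for `RationalCubePiKernelSingle` (stmt-26322) — see the module docstring; verbatim from the lens file. -/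
theorem cQ4_fn (z : Fin 2 → ℝ) : cQ4.fn z = 1 / (2 + z 1 + 2 * z 0 - 2 * z 1 * z 0) := by
  simp [cQ4, fn_apply]

/-- `cQ4_pos`: auxiliary theorem of the arctan-fibre calculus for `RationalCubePiKernelSingle` (stmt-26322) — see the module docstring; verbatim from the lens file. -/
theorem cQ4_pos {z : Fin 2 → ℝ} (hz : z ∈ KZ.cube 2) : (0 : ℝ) < (2 + z 1 + 2 * z 0 - 2 * z 1 * z 0) := by
  obtain ⟨⟨hy0, hy1⟩, hx0, hx1⟩ := mem_cube_two hz
  have hy1' : (0 : ℝ) ≤ 1 - z 0 := by linarith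
  have hx1' : (0 : ℝ) ≤ 1 - z 1 := by linarith
  nlinarith [mul_nonneg hx0 hy0, mul_nonneg hx0 hx1', mul_nonneg hy0 hy1', mul_nonneg hx1' hy1', sq_nonneg (2 * z 1 - 1), sq_nonneg (2 * z 0 - 1)]

/-- `cR1_ne`: auxiliary theorem of the arctan-fibre calculus for `RationalCubePiKernelSingle` (stmt-26322) — see the module docstring; verbatim from the lens file. -/
theorem cR1_ne : ∀ z ∈ KZ.cube 2, aeval z (3 + X 1 - 2 * X 1 * X 0 : MvPolynomial (Fin 2) ℚ) ≠ 0 := by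
  intro z hz
  obtain ⟨⟨hy0, hy1⟩, hx0, hx1⟩ := mem_cube_two hz
  have hy1' : (0 : ℝ) ≤ 1 - z 0 := by linarith
  have hx1' : (0 : ℝ) ≤ 1 - z 1 := by linarith
  have h : aeval z (3 + X 1 - 2 * X 1 * X 0 : MvPolynomial (Fin 2) ℚ) = (3 + z 1 - 2 * z 1 * z 0) := by simp
  rw [h]
  have hp : (0 : ℝ) < (3 + z 1 - 2 * z 1 * z 0) := by nlinarith [mul_nonneg hx0 hy0, mul_nonneg hx0 hx1', mul_nonneg hy0 hy1', mul_nonneg hx1' hy1', sq_nonneg (2 * z 1 - 1), sq_nonneg (2 * z 0 - 1)]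
  exact hp.ne'

/-- `[□, 1/(3+x−2xy)]` (the second half of `Q₃` under `x ↦ 2x`; `= Q₄(1−x,1−y)`). -/
def cR1 : RFun 2 := ⟨1, 3 + X 1 - 2 * X 1 * X 0, cR1_ne⟩

/-- `cR1_fn`: auxiliary theorem of the arctan-fibre calculus for `RationalCubePiKernelSingle` (stmt-26322) — see the module docstring; verbatim from the lens file. -/
theorem cR1_fn (z : Fin 2 → ℝ) : cR1.fn z = 1 / (3 + z 1 - 2 * z 1 * z 0) := by
  simp [cR1, fn_apply]

/-- `cR1_pos`: auxiliary theorem of the arctan-fibre calculus for `RationalCubePiKernelSingle` (stmt-26322) — see the module docstring; verbatim from the lens file. -/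
theorem cR1_pos {z : Fin 2 → ℝ} (hz : z ∈ KZ.cube 2) : (0 : ℝ) < (3 + z 1 - 2 * z 1 * z 0) := by
  obtain ⟨⟨hy0, hy1⟩, hx0, hx1⟩ := mem_cube_two hz
  have hy1' : (0 : ℝ) ≤ 1 - z 0 := by linarith
  have hx1' : (0 : ℝ) ≤ 1 - z 1 := by linarith
  nlinarith [mul_nonneg hx0 hy0, mul_nonneg hx0 hx1', mul_nonneg hy0 hy1', mul_nonneg hx1' hy1', sq_nonneg (2 * z 1 - 1), sq_nonneg (2 * z 0 - 1)]

/-- `[□, (1−2x)/(1+x+y−2xy)]` (the moment entry `[1/Q₃] = 2[x/Q₃]`). -/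
def mQ3odd : RFun 2 := ⟨1 - 2 * X 1, 1 + X 1 + X 0 - 2 * X 1 * X 0, cQ3_ne⟩

/-- `mQ3odd_fn`: auxiliary theorem of the arctan-fibre calculus for `RationalCubePiKernelSingle` (stmt-26322) — see the module docstring; verbatim from the lens file. -/
theorem mQ3odd_fn (z : Fin 2 → ℝ) : mQ3odd.fn z = (1 - 2 * z 1) / (1 + z 1 + z 0 - 2 * z 1 * z 0) := by
  simp [mQ3odd, fn_apply]

/-- `[□, (y−x)/(1+x+y−2xy)]` (the moment entry `[x/Q₃] = [y/Q₃]`). -/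
def mQ3anti : RFun 2 := ⟨X 0 - X 1, 1 + X 1 + X 0 - 2 * X 1 * X 0, cQ3_ne⟩

/-- `mQ3anti_fn`: auxiliary theorem of the arctan-fibre calculus for `RationalCubePiKernelSingle` (stmt-26322) — see the module docstring; verbatim from the lens file. -/
theorem mQ3anti_fn (z : Fin 2 → ℝ) : mQ3anti.fn z = (z 0 - z 1) / (1 + z 1 + z 0 - 2 * z 1 * z 0) := by
  simp [mQ3anti, fn_apply]

/-- `[□, x/(1+x+y−2xy)]` (census moment, `×1/12`). -/
def mQ3x : RFun 2 := ⟨X 1, 1 + X 1 + X 0 - 2 * X 1 * X 0, cQ3_ne⟩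

/-- `mQ3x_fn`: auxiliary theorem of the arctan-fibre calculus for `RationalCubePiKernelSingle` (stmt-26322) — see the module docstring; verbatim from the lens file. -/
theorem mQ3x_fn (z : Fin 2 → ℝ) : mQ3x.fn z = (z 1) / (1 + z 1 + z 0 - 2 * z 1 * z 0) := by
  simp [mQ3x, fn_apply]

/-- `[□, (1−2x)/G_a]` (the moment entry `[1/G_a] = 2[x/G_a]`). -/
def mGaodd : RFun 2 := ⟨1 - 2 * X 1, 1 + 2 * X 1 + 2 * X 0 - 2 * X 1 ^ 2 - 2 * X 0 ^ 2, cGa_ne⟩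

/-- `mGaodd_fn`: auxiliary theorem of the arctan-fibre calculus for `RationalCubePiKernelSingle` (stmt-26322) — see the module docstring; verbatim from the lens file. -/
theorem mGaodd_fn (z : Fin 2 → ℝ) : mGaodd.fn z = (1 - 2 * z 1) / (1 + 2 * z 1 + 2 * z 0 - 2 * z 1 ^ 2 - 2 * z 0 ^ 2) := by
  simp [mGaodd, fn_apply]

/-- `[□, (x−2xy)/G_a]` (the moment entry `[x/G_a] = 2[xy/G_a]`). -/
def mGaodd2 : RFun 2 := ⟨X 1 - 2 * X 1 * X 0, 1 + 2 * X 1 + 2 * X 0 - 2 * X 1 ^ 2 - 2 * X 0 ^ 2, cGa_ne⟩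

/-- `mGaodd2_fn`: auxiliary theorem of the arctan-fibre calculus for `RationalCubePiKernelSingle` (stmt-26322) — see the module docstring; verbatim from the lens file. -/
theorem mGaodd2_fn (z : Fin 2 → ℝ) : mGaodd2.fn z = (z 1 - 2 * z 1 * z 0) / (1 + 2 * z 1 + 2 * z 0 - 2 * z 1 ^ 2 - 2 * z 0 ^ 2) := by
  simp [mGaodd2, fn_apply]

end Objects

end Summit.KontsevichZagierPeriods.RootDecompRationalCubeDichotomy.ArctanFibre

end
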